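import Summits.BirchSwinnertonDyer.Rank1Residual.Additive.GreenbergKummerTameDescent
import Summits.BirchSwinnertonDyer.Rank1Residual.GaloisImage.GreenbergStrictOfNoInertiaInvariants
import Summits.BirchSwinnertonDyer.Rank1Residual.GaloisImage.GreenbergKerTwistTransport
import Literature.NumberTheory.EllipticCurves.Greenberg1999.KummerImageGoodOrdinary
import HarnessLib

/-!
# The 'Greenberg ⊆ Kummer' inclusion over `ℚ_∞` for the TWISTED datum of `E = C • V^{(c)}` at an
# additive potentially-good-ordinary `p`, from Greenberg's Prop. 2.4 for `V` over `ℚ(√c)·ℚ_∞`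
# (cell `b2b-bsdres`, team n1011, row T-RD-Δ-K = kernel half of r2's ROUTE-2 §II.15.3 ARM δ — the
# END theorem of the row; lead R5-40 (b); referee-1 ACK-1 v4; seat n1011-p05 gen 3)

HONEST FRAMING (cell `b2b-bsdres`, run/shared/lean/b2b/bsd-rank1-residual/, verbatim in every
file): the goal of the cell is to DELETE the COMBINATION-SHAPED residual classes of the
Birch–Swinnerton-Dyer formula for ALL analytic-rank `≤ 1` elliptic curves over `ℚ` — "full BSD
formula for every rank `≤ 1` curve in class `C`" assembled STRICTLY from published theorems — so
that the rank-`≤ 1` remainder becomes exactly the CONSTRUCTION-SHAPED classes, which are TYPED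
(missing-input `Prop`s), NOT attempted. This is not "finishing BSD". Team n1011 (X4 ∧ `p = 3`,
§I N10/N11; ROUTE-2 of planner r2): research route; TOOL theorems of Galois cohomology +
ONE assembly CONDITIONAL on the typed published fact
`Greenberg1999.imKummer_ge_strictCondition_goodOrdinary` (cc-typer-2, p262636), taken as a
hypothesis `hGrK` of exactly that `Prop` (referee 1, R1); no definition, no named fact by this seat;
nothing booked; no label changes.

## What and why (p05's choice, recorded per referee 1 CS-1: STRICT currency end to end, inertia
## only at the bottom level; typer differences (a) strictKer (b) `W := V` stand as printed)

Objects: `V/ℚ` globally minimal, GOOD ORDINARY at `p ≠ 2` (`p ∤ Δ_V`, `p ∤ a_p`); Greenberg's datum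
`N_V = reductionDatum V p` (`C_p = ker(V[p^∞] → Ṽ[p^∞])`, X2 lineage); `κ` the cyclotomic
`ℤ_p`-extension, `H' = ker κ = Gal(ℚ̄/ℚ_∞)`; `K = ℚ(θ)`, `θ² = c`, `U = galRange K = Gal(ℚ̄/K)`
(open normal of index `2`, prime to `p`); a target curve `W` (intended `W = C • V^{(c)}`) with an
additive isomorphism `t : V[p^∞] ≃+ W[p^∞]` that is sign-semilinear (`tsign`), equivariant on `U`
(`htU`) and anti-equivariant at some element of `I_{ℚ_v}` (`hanti`) — p10's `twistTransport` has all
three (`twistTransport_sign`, `twistTransport_smul_of_mem_galRange`,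
`exists_mem_absInertia_twistTransport_smul_eq_neg` for `ord_v c = 1`), and so has additive-p1's
`twistPrimaryEquiv`-based transport; the transported datum `N_W = twistMap N_V t` (p10).

* `strictKer_twistMap_le_localKerOver_inf` — level `H' ⊓ U` (`= Gal(ℚ̄/K·ℚ_∞)`): the FACT for `V`
  (`imKummer_ge_strictCondition_goodOrdinary.kerSubgroup_inf`, instantiated with X2's
  `specVal / localRed / reductionDatum` exactly as `GreenbergVatsalSelmerEqualityCited` does) moved to
  `W` along `t`: strict side by `GreenbergKerTwistTransport.mem_strictKer_iff_h1Equiv_mem_twistMap`,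
  Kummer side = hypothesis `hKum` (the local-points square for `t`; additive-p1's
  `TwistTransportLocal.mem_localKerOver_iff_twist` ∘ `VariableChangeSelmerOver.mem_localKerOver_iff_model`
  discharge it for the `twistPrimaryEquiv`-based `t`);
* **`greenbergKer_twistMap_kerSubgroup_le_localKerOver`** — level `H' = ker κ`:
  `N_W.greenbergKer (ker κ) ≤ W.localKerOver p (ker κ) ℚ_v`, i.e. r2's `hGrK` for the additive curve
  in GV currency: strict descent along `p ∤ [Γ_ℚ : U] = 2`
  (`GreenbergKummerTameDescent.strictKer_le_localKerOver_kerSubgroup_of_index_coprime`), then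
  inertia = strict at the bottom because an element of `I_v ∩ ker κ` acts as `−1` on
  `N_W.Gr = Ṽ[p^∞] ⊗ χ_c` (`GreenbergKerTwistTransport.exists_inertiaIn_kerSubgroup_map_smul_eq_neg`,
  `smul_eq_neg_twistMap_gr`, X2 `smul_gr_eq_of_mem_inertia`, and
  `GreenbergStrictOfNoInertiaInvariants.greenbergKer_eq_strictKer_of_smul_eq_neg`).

Hypothesis ledger of the end theorem: `hGrK` (the typed fact, CONDITIONAL), `hp2`, `hΔ`, `hord`,
`hκ`, `hpv`, `h2/hθ/hc` (the quadratic field), `tsign/htU/hanti` (the transport), `hKum` (Kummer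
square for `t` at level `ker κ ⊓ U`). Nothing else; no image hypothesis; `W` need not be minimal.

References: [GreenbergLNM1716] §2 Props. 2.2, 2.4 and remark (pp. 73–75), §5 p. 143;
[GreenbergVatsal2000] §2 p. 26; [SilvermanAEC2009] X.5 Cor. 5.4.
-/

noncomputable section

open scoped Classical

namespace Summit.BirchSwinnertonDyer.Rank1Residual.Additive.TameDescent

open NumberField IsDedekindDomain Field Literature.NumberTheory.GaloisRepresentations
  Literature.NumberTheory.EllipticCurves Literature.NumberTheory.EllipticCurves.GreenbergSelmer
  Literature.NumberTheory.EllipticCurves.Greenberg1999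
  Summit.BirchSwinnertonDyer.Rank1Residual.X2.GreenbergVatsalReductionDatum
  Summit.BirchSwinnertonDyer.Rank1Residual.X2.GreenbergVatsalStrictAtPQuotient
  Summit.BirchSwinnertonDyer.Rank1Residual.GaloisImage
  Summit.BirchSwinnertonDyer.Rank1Residual.GaloisImage.RamifiedOrdinaryLineTwist

variable (V : WeierstrassCurve ℚ) [V.IsElliptic] [V.IsGloballyMinimal] (p : ℕ) [Fact p.Prime]
  (κ : ZpExtension ℚ p) {v : HeightOneSpectrum (𝓞 ℚ)} {W : WeierstrassCurve ℚ}
  (t : V.geomPrimaryTorsion p ≃+ W.geomPrimaryTorsion p)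
  (tsign : ∀ g : absoluteGaloisGroup ℚ, (∀ m, t (g • m) = g • t m) ∨ (∀ m, t (g • m) = -(g • t m)))

/-- **Level `ker κ ⊓ U` (`= Gal(ℚ̄/F·ℚ_∞)`, `F = ℚ̄^U`): the strict 'Greenberg ⊆ Kummer' inclusion
for the transported datum on `W`**, from Greenberg's Prop. 2.4 for the good ordinary `V`
(hypothesis `hGrK` = cc-typer-2's typed fact, instantiated at X2's reduction datum) and the two
transports along `t` at a level where `t` is equivariant: the strict side
(`mem_strictKer_iff_h1Equiv_mem_twistMap`) and the Kummer side (hypothesis `hKum`).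
[cite: GreenbergLNM1716, §2 Prop. 2.4 and remark (pp. 74–75)] -/
theorem strictKer_twistMap_le_localKerOver_inf (hGrK : imKummer_ge_strictCondition_goodOrdinary)
    (hΔ : ¬ (p : ℤ) ∣ V.minimalDiscriminantInt) (hord : ¬ (p : ℤ) ∣ V.frobeniusTrace p)
    (hκ : κ.IsCyclotomic) (hpv : ((p : ℕ) : 𝓞 ℚ) ∈ v.asIdeal)
    (U : Subgroup (absoluteGaloisGroup ℚ)) (hUo : IsOpen (U : Set (absoluteGaloisGroup ℚ)))
    [U.FiniteIndex] (ht : ∀ (g : ↥(κ.kerSubgroup ⊓ U)) (m : V.geomPrimaryTorsion p), t (g • m) = g • t m)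
    (hKum : ∀ s : V.subgroupH1 p (κ.kerSubgroup ⊓ U),
      s ∈ V.localKerOver p (κ.kerSubgroup ⊓ U) (v.adicCompletion ℚ) ↔
        h1Equiv (G := ↥(κ.kerSubgroup ⊓ U)) t ht s ∈
          W.localKerOver p (κ.kerSubgroup ⊓ U) (v.adicCompletion ℚ)) :
    (twistMap (reductionDatum V p hpv hΔ) t tsign).strictKer (κ.kerSubgroup ⊓ U) ≤
      W.localKerOver p (κ.kerSubgroup ⊓ U) (v.adicCompletion ℚ) := by
  intro s' hs'
  have hV : (reductionDatum V p hpv hΔ).strictKer (κ.kerSubgroup ⊓ U) ≤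
      V.localKerOver p (κ.kerSubgroup ⊓ U) (v.adicCompletion ℚ) :=
    imKummer_ge_strictCondition_goodOrdinary.kerSubgroup_inf V p hΔ hord κ hκ v hpv (specVal v)
      (specVal_spec v) (localRed V p hpv hΔ) (localRed_apply V p hpv hΔ) (reductionDatum V p hpv hΔ)
      (mem_reductionDatum_plus_iff V p hpv hΔ) hGrK U (U.isClosed_of_isOpen hUo)
  have h1 : (h1Equiv (G := ↥(κ.kerSubgroup ⊓ U)) t ht).symm s' ∈
      (reductionDatum V p hpv hΔ).strictKer (κ.kerSubgroup ⊓ U) := by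
    rw [mem_strictKer_iff_h1Equiv_mem_twistMap (κ.kerSubgroup ⊓ U) (reductionDatum V p hpv hΔ) t
      tsign ht, AddEquiv.apply_symm_apply]
    exact hs'
  have h3 := (hKum _).1 (hV h1)
  rw [AddEquiv.apply_symm_apply] at h3
  exact h3

omit [V.IsElliptic] in
/-- The transported datum's quotient `W[p^∞]/t(C_p)` is `p`-primary. [folklore] -/
theorem exists_pow_nsmul_eq_zero_twistMap_gr (hpv : ((p : ℕ) : 𝓞 ℚ) ∈ v.asIdeal)
    (hΔ : ¬ (p : ℤ) ∣ V.minimalDiscriminantInt)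
    (d : (twistMap (reductionDatum V p hpv hΔ) t tsign).Gr) : ∃ k : ℕ, p ^ k • d = 0 := by
  obtain ⟨m, rfl⟩ := (twistMap (reductionDatum V p hpv hΔ) t tsign).grMk_surjective d
  obtain ⟨k, hk⟩ := AddCommGroup.mem_primaryComponent.mp m.2
  refine ⟨k, ?_⟩
  have hm : p ^ k • m = 0 :=
    Subtype.ext (by rw [AddSubmonoidClass.coe_nsmul, hk, ZeroMemClass.coe_zero])
  rw [← map_nsmul, hm, map_zero]

variable (K : Type) [Field K] [NumberField K] (h2 : Module.finrank ℚ K = 2) {θ : K} {c : ℚ}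
  (hθ : θ ∉ Set.range (algebraMap ℚ K)) (hc : θ ^ 2 = algebraMap ℚ K c)

omit [V.IsElliptic] [V.IsGloballyMinimal] in
/-- `t` equivariant on `galRange K` is equivariant on `ker κ ⊓ galRange K`. [folklore] -/
theorem smul_of_mem_inf_galRange
    (htU : ∀ g ∈ galRange (K := ℚ) K, ∀ m : V.geomPrimaryTorsion p, t (g • m) = g • t m)
    (g : ↥(κ.kerSubgroup ⊓ galRange (K := ℚ) K)) (m : V.geomPrimaryTorsion p) :
    t (g • m) = g • t m :=
  htU g.1 (Subgroup.mem_inf.1 g.2).2 m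

include h2 hθ hc in
/-- **END THEOREM of row T-RD-Δ-K — the 'Greenberg ⊆ Kummer' inclusion over `ℚ_∞` for the twisted
datum, in Greenberg–Vatsal's INERTIA currency:
`(twistMap N_V t).greenbergKer (ker κ) ≤ W.localKerOver p (ker κ) ℚ_v`.** From the typed fact
`hGrK` for `V` over `K·ℚ_∞` (`K = ℚ(√c)`, `[Γ_ℚ : Gal(ℚ̄/K)] = 2` prime to `p`): strict transport
at level `ker κ ⊓ Gal(ℚ̄/K)` (`strictKer_twistMap_le_localKerOver_inf`), strict prime-to-`p`
descent to `ker κ` (`strictKer_le_localKerOver_kerSubgroup_of_index_coprime`), and inertia = strict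
at `ker κ` because an element of `I_v ∩ ker κ` acts as `−1` on `Ṽ[p^∞] ⊗ χ_c`
(`exists_inertiaIn_kerSubgroup_map_smul_eq_neg`, `smul_eq_neg_twistMap_gr`,
`greenbergKer_eq_strictKer_of_smul_eq_neg`). CONDITIONAL on `hGrK` and on the Kummer square `hKum`.
[cite: GreenbergLNM1716, §2 Props. 2.2, 2.4 (pp. 73–75), §5 p. 143] [cite: GreenbergVatsal2000, §2 p. 26] -/
theorem greenbergKer_twistMap_kerSubgroup_le_localKerOver
    (hGrK : imKummer_ge_strictCondition_goodOrdinary) (hp2 : p ≠ 2)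
    (hΔ : ¬ (p : ℤ) ∣ V.minimalDiscriminantInt) (hord : ¬ (p : ℤ) ∣ V.frobeniusTrace p)
    (hκ : κ.IsCyclotomic) (hpv : ((p : ℕ) : 𝓞 ℚ) ∈ v.asIdeal)
    (htU : ∀ g ∈ galRange (K := ℚ) K, ∀ m : V.geomPrimaryTorsion p, t (g • m) = g • t m)
    (hanti : ∃ σ ∈ absInertia (v.adicCompletion ℚ), ∀ m : V.geomPrimaryTorsion p,
      t (absGaloisRestrict ℚ (v.adicCompletion ℚ) σ • m) =
        -(absGaloisRestrict ℚ (v.adicCompletion ℚ) σ • t m))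
    (hKum : ∀ s : V.subgroupH1 p (κ.kerSubgroup ⊓ galRange (K := ℚ) K),
      s ∈ V.localKerOver p (κ.kerSubgroup ⊓ galRange (K := ℚ) K) (v.adicCompletion ℚ) ↔
        h1Equiv (G := ↥(κ.kerSubgroup ⊓ galRange (K := ℚ) K)) t
            (smul_of_mem_inf_galRange V p κ t K htU) s ∈
          W.localKerOver p (κ.kerSubgroup ⊓ galRange (K := ℚ) K) (v.adicCompletion ℚ)) :
    (twistMap (reductionDatum V p hpv hΔ) t tsign).greenbergKer κ.kerSubgroup ≤
      W.localKerOver p κ.kerSubgroup (v.adicCompletion ℚ) := by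
  haveI : IsGalois ℚ K := isGalois_of_finrank_eq_two K h2
  have hσ₀ := sigmaQ_ne_one K h2 hθ hc
  haveI : (galRange (K := ℚ) K).Normal := normal_galRange K h2 hσ₀
  haveI : (galRange (K := ℚ) K).FiniteIndex :=
    ⟨by rw [index_galRange K h2 hσ₀]; exact two_ne_zero⟩
  have hUo : IsOpen (galRange (K := ℚ) K : Set (absoluteGaloisGroup ℚ)) := isOpen_galRange K
  -- level `ker κ ⊓ galRange K`, strict currency
  have hU := strictKer_twistMap_le_localKerOver_inf V p κ t tsign hGrK hΔ hord hκ hpv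
    (galRange (K := ℚ) K) hUo (smul_of_mem_inf_galRange V p κ t K htU) hKum
  -- descend to `ker κ`
  have hcop : (galRange (K := ℚ) K).index.Coprime p := by
    rw [index_galRange K h2 hσ₀]
    exact (Nat.coprime_primes Nat.prime_two (Fact.out : p.Prime)).2 (Ne.symm hp2)
  have hstrict := strictKer_le_localKerOver_kerSubgroup_of_index_coprime W p
    (twistMap (reductionDatum V p hpv hΔ) t tsign) κ hUo hcop hU
  -- inertia = strict at `ker κ`
  obtain ⟨τ, hτ⟩ := exists_inertiaIn_kerSubgroup_map_smul_eq_neg K h2 hθ hc p t κ hκ hp2 hpv htU hanti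
  have hτneg : ∀ d : (twistMap (reductionDatum V p hpv hΔ) t tsign).Gr, τ • d = -d := fun d ↦
    smul_eq_neg_twistMap_gr (reductionDatum V p hpv hΔ) t tsign (τ : decomp (K := ℚ) v) hτ
      (fun d ↦ smul_gr_eq_of_mem_inertia V p hpv hΔ ((mem_inertiaIn_iff κ.kerSubgroup v _).1 τ.2).2 d) d
  rw [greenbergKer_eq_strictKer_of_smul_eq_neg κ.kerSubgroup
    (twistMap (reductionDatum V p hpv hΔ) t tsign) hp2
    (exists_pow_nsmul_eq_zero_twistMap_gr V p t tsign hpv hΔ) τ hτneg]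
  exact hstrict

end Summit.BirchSwinnertonDyer.Rank1Residual.Additive.TameDescent

end
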